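import Mathlib.Computability.Language
import Literature.Computability.Complexity.CNF
import Literature.Computability.Cryptography.Subexponential
import Literature.Computability.Cryptography.SNP
import Literature.Computability.FineGrained.FineGrainedWave0
import HarnessLib

-- provenance: harness21/H21/H21/Statements/FineGrained/SerfSNP.lean @ 69461ad (interim HEAD d8f2665); M5 mechanical rewrite
/-!
# Fine-grained complexity: ETH, SERF reductions and SNP-completeness of k-SAT

Family `fine-grained` (trunk `CryptoQuantFine`, outline §3 `FineGrained/SerfSNP`), statement
**fine-grained.S06**:

> ETH ⇔ ∃ k, s_k > 0 ⇔ linear-size 3-SAT needs `2^{Ω(n)}`; k-SAT ∈ SE ⇔ SNP ⊆ SE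
> (Impagliazzo–Paturi–Zane 2001, Corollaries 1–2, Theorem 3).

We view `k`-SAT as an IPZ *parameterised problem* in two ways: `kSATParam k` (the accepted
language `Literature.CplxCore.kSAT k` of satisfiable width-`≤ k` CNFs over `{0,1}`, parameter the number
of variables `CNF.numVars`) and `kSATClauseParam k` (same language, parameter the number of
clauses `CNF.numClauses`). The four printed equivalences become

* `eth_iff_exists_satExponent_pos : ETH ↔ ∃ k ≥ 3, 0 < s_k` (IPZ Cor. 1, via
  Impagliazzo–Paturi);
* `eth_iff_kSATParam_three_not_mem_SE : ETH ↔ kSATParam 3 ∉ SE` (bridge between the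
  `Γ'`-encoded `KCNF 3` model of `Wave0` and the `SE`/`ParamProblem` model of the prelude);
* `eth_iff_kSATClauseParam_not_mem_SE : ETH ↔ kSATClauseParam 3 ∉ SE` ("3-SAT with parameter
  `m` — equivalently linear-size 3-SAT — needs time `2^{Ω(m)}`", IPZ Cor. 2, via the
  sparsification lemma packaged as the SERF reduction
  `serfReducible_kSATParam_kSATClauseParam`);
* `forall_kSATParam_mem_SE_iff_SNP_subset_SE : (∀ k ≥ 3, kSATParam k ∈ SE) ↔ SNP ⊆ SE`
  (IPZ Thm. 3: `k`-SAT is SNP-complete under SERF reductions), together with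
  `exists_snp_kSAT` (`k`-SAT is, up to SERF-equivalence of encodings, an SNP problem).

All theorems are known results in print and are `sorry`d.

## Mathlib search

Mathlib has `Language` and `Computability.Encoding` (reused through the accepted preludes) but no
ETH, SE, SERF, SNP or k-SAT-as-language (searched `ETH`, `Subexp`, `SERF`, `SNP`, `kSAT`);
everything used here comes from the accepted H21 modules `CplxCore.CNF` (`encodingCNF`, `kSAT`,
`CNF.numVars`, `CNF.numClauses`, `CNF.IsWidthLE`, `CNF.Satisfiable`),
`CryptoQuantFine.Subexponential` (`ParamProblem.ofEncoding`, `SE`, `SERFReducible`),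
`CryptoQuantFine.SNP` (`SNP`, `SNPFormula.toParamProblem`) and `Statements.FineGrained.Wave0`
(`ETH`, `satExponent`).

## Design notes

* `CNF.numVars φ` is `1 + ` the largest variable index of `φ` (and `0` if none occurs), which is
  the IPZ parameter `n` for formulas on the variables `x₀, …, x_{n-1}`; formulas with sparse
  variable indices only get a *larger* parameter, and a SERF reduction may rename variables in
  polynomial time, so `SE`-membership and SERF-degrees are the printed ones.
* `SERFReducible` is the deterministic notion of the prelude (IPZ also allow randomised SERF
  reductions, outline R2); all reductions asserted here are deterministic in print.
* Both directions between the two parameters are recorded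
  (`serfReducible_kSATParam_kSATClauseParam`, sparsification, and the easy converse
  `serfReducible_kSATClauseParam_kSATParam`, variable renaming), although only the first is
  needed for IPZ Cor. 2.

## References

* R. Impagliazzo, R. Paturi, F. Zane, *Which problems have strongly exponential complexity?*,
  J. Comput. System Sci. 63 (2001) 512–530: Cor. 1, Cor. 2 (§2), Thm. 3 (§3).
  [ImpagliazzoPaturiZaneJCSS2001]
* R. Impagliazzo, R. Paturi, *On the complexity of k-SAT*, J. Comput. System Sci. 62 (2001),
  §1 and Cor. 2 (`s_3 > 0 ⇔ ∃ k, s_k > 0`). [ImpagliazzoPaturiJCSS2001]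
* H21 outline `CryptoQuantFine`, §3 `FineGrained/SerfSNP`, R2.
-/

namespace Literature.Computability.FineGrained

open _root_.Computability Complexity Cryptography

/-! ### k-SAT as a parameterised problem -/

/-- `k`-SAT as an IPZ parameterised problem with parameter `n`, the number of variables: the
language is `kSAT k = encodingCNF.toLanguage {φ | φ.IsWidthLE k ∧ φ.Satisfiable}` and the
parameter of the codeword of `φ` is `φ.numVars` (junk value `0` off-code, see
`ParamProblem.ofEncoding`). [Impagliazzo–Paturi–Zane 2001, §2 ("k-SAT with parameter n")]
[cite: ImpagliazzoPaturiZaneJCSS2001, §2 (k-SAT with parameter n)] -/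
noncomputable def kSATParam (k : ℕ) : ParamProblem :=
  ParamProblem.ofEncoding encodingCNF {φ | φ.IsWidthLE k ∧ φ.Satisfiable} CNF.numVars

/-- `k`-SAT as an IPZ parameterised problem with parameter `m`, the number of clauses (same
language `kSAT k`). Since a `k`-CNF with `m` clauses has size `O(k m log(k m))`, this is
"linear-size `k`-SAT" up to SERF-equivalence.
[Impagliazzo–Paturi–Zane 2001, §2 ("k-SAT with parameter m"), Cor. 2]
[cite: ImpagliazzoPaturiZaneJCSS2001, §2 (k-SAT with parameter m)] -/
noncomputable def kSATClauseParam (k : ℕ) : ParamProblem :=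
  ParamProblem.ofEncoding encodingCNF {φ | φ.IsWidthLE k ∧ φ.Satisfiable} CNF.numClauses

/-- The language of `kSATParam k` is `kSAT k` (definitional). [Impagliazzo–Paturi–Zane 2001, §2]
[cite: ImpagliazzoPaturiZaneJCSS2001, §2] -/
@[simp] theorem kSATParam_lang (k : ℕ) : (kSATParam k).lang = kSAT k :=
  rfl

/-- The language of `kSATClauseParam k` is `kSAT k` (definitional).
[Impagliazzo–Paturi–Zane 2001, §2] [cite: ImpagliazzoPaturiZaneJCSS2001, §2] -/
@[simp] theorem kSATClauseParam_lang (k : ℕ) : (kSATClauseParam k).lang = kSAT k :=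
  rfl

/-- On the codeword of `φ` the parameter of `kSATParam k` is `φ.numVars`.
[Impagliazzo–Paturi–Zane 2001, §2] [cite: ImpagliazzoPaturiZaneJCSS2001, §2] -/
@[simp] theorem kSATParam_param_encode (k : ℕ) (φ : CNF ℕ) :
    (kSATParam k).param (encodingCNF.encode φ) = φ.numVars :=
  ParamProblem.ofEncoding_param_encode _ _ _ _

/-- On the codeword of `φ` the parameter of `kSATClauseParam k` is `φ.numClauses`.
[Impagliazzo–Paturi–Zane 2001, §2] [cite: ImpagliazzoPaturiZaneJCSS2001, §2] -/
@[simp] theorem kSATClauseParam_param_encode (k : ℕ) (φ : CNF ℕ) :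
    (kSATClauseParam k).param (encodingCNF.encode φ) = φ.numClauses :=
  ParamProblem.ofEncoding_param_encode _ _ _ _

/-! ### SERF reductions between the two parameters -/

/-- Sparsification as a SERF reduction: `k`-SAT with parameter `n` (variables) SERF-reduces to
`k`-SAT with parameter `m` (clauses). Given `ε`, sparsify `φ` into `≤ 2^{ε n}` `k`-CNFs with
`≤ C(k, ε) · n` clauses each and query them. [Impagliazzo–Paturi–Zane 2001, §2, Cor. 1–2
(sparsification lemma ⇒ SERF reduction from parameter `n` to parameter `m`)]
[cite: ImpagliazzoPaturiZaneJCSS2001, §2 Cor. 1–2 (sparsification lemma ⇒ SERF)] -/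
def serfReducible_kSATParam_kSATClauseParam : Prop :=
  ∀ (k : ℕ),
    SERFReducible (kSATParam k) (kSATClauseParam k)

/-- The easy converse: `k`-SAT with parameter `m` SERF-reduces to `k`-SAT with parameter `n`
(rename the at most `k m` occurring variables to `x₀, …, x_{km-1}` in polynomial time and ask
one query, whose parameter is `≤ k · m`). [Impagliazzo–Paturi–Zane 2001, §2]
[cite: ImpagliazzoPaturiZaneJCSS2001, §2] -/
def serfReducible_kSATClauseParam_kSATParam : Prop :=
  ∀ (k : ℕ),
    SERFReducible (kSATClauseParam k) (kSATParam k)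

/-! ### fine-grained.S06 -/

/-- **fine-grained.S06** (Impagliazzo–Paturi–Zane, JCSS 63 (2001), Cor. 1; Impagliazzo–Paturi,
JCSS 62 (2001), Cor. 2.) `ETH ⇔ ∃ k ≥ 3, s_k > 0`: 3-SAT requires exponential time iff some
`k`-SAT does (the nontrivial direction is `s_k > 0 ⇒ s_3 > 0`, by sparsification and the
standard width reduction `k`-SAT `→` 3-SAT, which is linear in the number of clauses).
[cite: ImpagliazzoPaturiZaneJCSS2001, §2 Cor. 1; ImpagliazzoPaturiJCSS2001 Cor. 2] -/
def eth_iff_exists_satExponent_pos : Prop :=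
  ETH ↔ ∃ k : ℕ, 3 ≤ k ∧ 0 < satExponent k

/-- **fine-grained.S06** (Impagliazzo–Paturi–Zane, JCSS 63 (2001), §2; bridge lemma.)
`ETH ⇔ 3-SAT ∉ SE` for the parameter `n` = number of variables: the `Wave0` formulation over
`Γ'`-encoded `KCNF 3` (`¬ KSATInExpTime 3 δ` for some `δ > 0`) agrees with non-membership of the
`{0,1}`-encoded parameterised problem `kSATParam 3` in `SE` (the two encodings are polynomially
inter-translatable, and `KCNF.numVars` vs `CNF.numVars` differ only by unused variables, which a
polynomial-time renaming removes). Encoding bridge between two formalisations. [folklore] -/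
def eth_iff_kSATParam_three_not_mem_SE : Prop :=
  ETH ↔ kSATParam 3 ∉ SE

/-- **fine-grained.S06** (Impagliazzo–Paturi–Zane, JCSS 63 (2001), Cor. 2.) `ETH` iff 3-SAT with
parameter `m` (the number of clauses) is not in `SE`, i.e. iff linear-size 3-SAT requires time
`2^{Ω(n)}`: by sparsification (`serfReducible_kSATParam_kSATClauseParam`) and closure of `SE`
under SERF reductions. [cite: ImpagliazzoPaturiZaneJCSS2001, §2 Cor. 2] -/
def eth_iff_kSATClauseParam_not_mem_SE : Prop :=
  ETH ↔ kSATClauseParam 3 ∉ SE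

/-- **fine-grained.S06** (Impagliazzo–Paturi–Zane, JCSS 63 (2001), Thm. 3: `k`-SAT, `k ≥ 3`, is
SNP-complete under SERF reductions with respect to the witness-size parameter.) `k`-SAT with
parameter `n` lies in `SE` for every `k ≥ 3` iff every SNP problem (parameter
`∑ᵢ n^{arity Sᵢ}`) lies in `SE`. [cite: ImpagliazzoPaturiZaneJCSS2001, §3 Thm. 3] -/
def forall_kSATParam_mem_SE_iff_SNP_subset_SE : Prop :=
  (∀ k : ℕ, 3 ≤ k → kSATParam k ∈ SE) ↔ SNP ⊆ SE

/-- **fine-grained.S06** (Impagliazzo–Paturi–Zane, JCSS 63 (2001), §3, proof of Thm. 3: "k-SAT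
is in SNP".) For every `k` there is an SNP formula `Φ` (inputs: `2^k` relations of arity `k`, one
per sign pattern of a clause; witness: one unary relation, the assignment; so the parameter is the
number `n` of variables) whose parameterised problem is SERF-equivalent to `kSATParam k` — the two
differ only by the encoding of instances.
[cite: ImpagliazzoPaturiZaneJCSS2001, §3, proof of Thm. 3 (k-SAT ∈ SNP)] -/
def exists_snp_kSAT : Prop :=
  ∀ (k : ℕ),
    ∃ Φ : SNPFormula, SERFReducible (kSATParam k) Φ.toParamProblem ∧
      SERFReducible Φ.toParamProblem (kSATParam k)

end Literature.Computability.FineGrained
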